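import Literature.AlgebraicGeometry.ModuliOfAbelianVarieties.SiegelAdmissibleClassUnique
import Literature.AlgebraicGeometry.ModuliOfAbelianVarieties.SiegelPairingReadOfTypeFrame
import Literature.AlgebraicGeometry.ModuliOfAbelianVarieties.SiegelFamilyIsotropicKernelDescent
import Literature.AlgebraicGeometry.ModuliOfAbelianVarieties.SiegelAdelicMarkingTorusPresentation
import Literature.AlgebraicGeometry.Motives.AbelianVarietyWeilPairingNormalForm
import Literature.AlgebraicGeometry.Motives.AbelianVarietyPolarizationTypeAnalytic
import Literature.AlgebraicGeometry.Motives.AbelianVarietyAmpleRiemannForm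
import Literature.Geometry.Kaehler.ComplexTorusDualPolarizationGysin
import HarnessLib

/-!
# The frame of an admissibility marking is symplectic of type `δ` for `c₁(Θ^an)` (U-e P4b base case (G₀))

Topic `AlgebraicGeometry/ModuliOfAbelianVarieties`; namespace `Literature.AlgebraicGeometry.ModuliOfAbelianVarieties`.
KERNEL ONLY: theorems; no definition, no named fact, no instance, no `sorry`.  Cell `hodgecm-mathlib` (D-0151), rung-0
(U)-road, U-e socket P4b (B-p05 (g13) lead, GO 14:31:42Z): the `x₀` base case (G₀) of the Gram-flatness node (N3) and of
LAYER A's pairing input.  HC_CM is proved only modulo the 7 printed citations until rung 0 closes; nothing here changes that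
count (books 0).

STATEMENT.  Let `P′`-style data over `Spec ℂ` be given: an abelian scheme `B` with a polarisation `pol` OF TYPE `δ`
(★ `Polarization.HasType`), a point `s`, an ample `Θ` on the fibre with `λ̄ = Λ(𝒪(Θ))` (★ `IsLambdaOfAt`), a level-`N`
structure `φ` with a symplectic lift `Λ` for `Θ` (★ D3 `SymplecticLift`), and a T1′ marking `m` of the fibre by `[J(Z₀), r]`,
`Z₀ ∈ 𝔥_g`, `r ∈ K_δ(1)`, with basis matrix `m.γ = 1`, MATCHED to `Λ` through `r` (the tower clause of ★ `IsAdmissibleAt`: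
`Λ.lift M x = m.r v` whenever `r⁻¹ v ≡ x/M`).  Then for every Appell–Humbert datum `p` of `[𝒪(Θ)^an]` on the marking's
own uniformisation `(m.Ψ, m.toFun)`:  `intGram m.Ψ p.form = typeForm δ` — the lattice frame of the marking is a symplectic
basis of type `δ` for `E = c₁(Θ^an)` ([LangeBirkenhake1992] §8.1 / [Lange2023] §3.1: «the period matrix of a polarized abelian
variety of type `D` with respect to a symplectic basis»; [Milne2005ShimuraVarieties] Thm. 6.11: `ψ ↦ ±` a multiple of
`E_δ` under the marking; [Deligne1971TravauxShimura] 4.12 (b)).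

PROOF (all engines ★).  (1) ★ D5 `weilPairingLevel_eq_cexp_intGram` read through `1` (the trick
`obtain rfl : g = A.dim := m.dim_eq.symm` of ★ `pairingRead_one_of_intGram_eq_typeForm` puts `m.Ψ` on D5's model):
`ē_M(m.r(x̃/M), m.r(ỹ/M)) = e(2πi·ᵗx̃Gỹ/M)`, `G := intGram m.Ψ p.form`.  (2) `Λ`'s pairing clause read at the relabelled
classes `Γ_M x` of the similitude tower of `r⁻¹` (★ `exists_similitudeTower`, ★ `adelicCongr_val_div_of_entries_residue`,
★ `SymplecticLift.weilPairingLevel_lift`) and `ζ_M = e(2πi/M)^b` (★ `IsPrimitiveRoot.eq_pow_of_pow_eq_one`) give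
`G ≡ c_M · E_δ (mod M)` for every `M = N·k`, hence `δ₀ • G = G_{λ₀μ₀} • E_δ` over `ℤ` (an integer congruence modulo every
`N·k` is an equality — the pattern of ★ `smul_transpose_mul_typeForm_mul_eq_of_lifts`).  (3) `|G_{λ₀μ₀}| = δ₀`: both `G` and
`E_δ` have determinant `(∏ δᵢ)²` (★ `HasType.complexTorus_isPolarizationType` + ★ `isRiemannForm_of_isAmple` for `G`, the
Siegel model ★ `isPolarizationType_siegelForm` for `E_δ`, ★ `IsPolarizationType.det_intGram_eq_sq`).  (4) The sign is `+`:
`p.form` is a Riemann form and `m.Ψ` is `ℂ`-linear for `J(Z₀)` (`Ψ_J`), while the model form `E^δ_{Z₀}` with Gram matrix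
`E_δ` is positive for the same `J(Z₀)` (★ `isRiemannForm_siegelForm`, ★ `latticeGram_siegelForm`,
★ `siegelPeriodMap_jOfSiegel_mulVec`), so `G = −E_δ` would make `p.form(iu, u) < 0`.

* `intGram_eq_typeForm_of_symplecticLift` — the statement above;
* `exists_ahData_intGram_eq_typeForm_of_symplecticLift` — `∃ p, toPic p = [𝒪(Θ)^an] ∧ intGram m.Ψ p.form = typeForm δ`,
  i.e. B-typ02 (g11)'s `SiegelMarkingFamily.IsFlatGram` clause at `x₀` / the `hgram` input of ★ (B4)
  `exists_pairingRead_forall_of_intGram_eq_typeForm`.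

## References
* [Milne2005ShimuraVarieties] J. S. Milne, *Introduction to Shimura Varieties* (2005), §6 Thm. 6.11 pp. 74–75 and p. 75.
* [Deligne1971TravauxShimura] P. Deligne, Travaux de Shimura (1971), 4.12 (b) p. 149, Exemple 4.16 p. 150.
* [Lan2013PELCompactifications] K.-W. Lan, *Arithmetic compactifications of PEL-type Shimura varieties* (2013), §1.3.6
  Def. 1.3.6.2 (p. 80), Lemma 1.3.6.5 (p. 81).
* [LangeBirkenhake1992] H. Lange, Ch. Birkenhake, *Complex Abelian Varieties* (1992), §8.1 Prop. 8.1.1.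
* [Lange2023AbelianVarietiesComplex] H. Lange, *Abelian Varieties over the Complex Numbers* (2023), §3.1.1 Prop. 3.1.1 (p. 162).
-/

set_option autoImplicit false

noncomputable section

open Matrix CategoryTheory AlgebraicGeometry Complex

namespace Literature.AlgebraicGeometry.ModuliOfAbelianVarieties

open Literature.AlgebraicGeometry.Motives (AbelianVariety AlgPoints CartierDivisor specOver ComplexPoints)
open Literature.AlgebraicGeometry.AbelianSchemes (AbelianSchemeOver PolarizedAbelianSchemeWithLevel)
open Literature.Geometry.Kaehler (ComplexTorus)
open Literature.Geometry.Kaehler.ComplexTorus (AHData proj intGram picClass latticeGram IsRiemannForm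
  dotProduct_latticeGram_mulVec map_intGram)
open Literature.NumberTheory.Transcendental (IsAnalytification)
open Literature.AlgebraicGeometry.HodgeTheory (cartierDivisorLineBundle)
open Literature.NumberTheory.Adeles
open Literature.NumberTheory.Automorphic (siegelUpperHalfSpace)
open SiegelModuli

variable {g : ℕ} {δ : Fin g → ℕ}

/-! ### §0 Elementary plumbing -/

section Elementary

/-- `e(2πi k / M) = e(2πi / M) ^ (k mod M)` for an integer `k` (`M ≠ 0`). [folklore] -/
private theorem cexp_intCast_div_eq_pow' {M : ℕ} (hM : M ≠ 0) (k : ℤ) :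
    cexp (2 * Real.pi * I * (((k : ℝ) / M : ℝ) : ℂ)) = cexp (2 * Real.pi * I / M) ^ ((k : ZMod M).val) := by
  haveI : NeZero M := ⟨hM⟩
  have hMc : (M : ℂ) ≠ 0 := Nat.cast_ne_zero.2 hM
  set ζ := cexp (2 * Real.pi * I / M) with hζ
  have hζM : ζ ^ M = 1 := by
    rw [hζ, ← Complex.exp_nat_mul, mul_div_cancel₀ _ hMc, Complex.exp_two_pi_mul_I]
  have h1 : cexp (2 * Real.pi * I * (((k : ℝ) / M : ℝ) : ℂ)) = ζ ^ k := by
    rw [hζ, ← Complex.exp_int_mul]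
    congr 1
    push_cast
    ring
  have hr : ((k : ZMod M).val : ℤ) = k % M := ZMod.val_intCast k
  have hk : k = M * (k / M) + ((k : ZMod M).val : ℤ) := by
    rw [hr]
    have := Int.emod_add_mul_ediv k (M : ℤ)
    linarith
  rw [h1]
  conv_lhs => rw [hk]
  rw [zpow_add₀ (Complex.exp_ne_zero _), ← hζ, _root_.zpow_mul, zpow_natCast, hζM, _root_.one_zpow, one_mul,
    zpow_natCast]

/-- Reduction mod `M` of `ᵗx̃ G ỹ` for the standard lifts `x̃, ỹ` of `x, y ∈ (ℤ/M)^n`. [folklore] -/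
private theorem intCast_dotProduct_mulVec_val {n : Type} [Fintype n] (M : ℕ) [NeZero M] (G : Matrix n n ℤ)
    (x y : n → ZMod M) :
    ((((fun i ↦ ((x i).val : ℤ)) ⬝ᵥ G *ᵥ (fun i ↦ ((y i).val : ℤ)) : ℤ)) : ZMod M) =
      x ⬝ᵥ (G.map (Int.castRingHom (ZMod M))) *ᵥ y := by
  simp only [dotProduct, Matrix.mulVec, Matrix.map_apply, eq_intCast, Int.cast_sum, Int.cast_mul, Int.cast_natCast,
    ZMod.natCast_zmod_val]

/-- An integer divisible by `N·k` for every `k ≠ 0` (`N ≠ 0`) is zero. [folklore] -/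
private theorem int_eq_zero_of_forall_dvd' {N : ℕ} (hN : N ≠ 0) {z : ℤ}
    (h : ∀ k : ℕ, k ≠ 0 → ((N * k : ℕ) : ℤ) ∣ z) : z = 0 := by
  have hk : z.natAbs + 1 ≠ 0 := Nat.succ_ne_zero _
  refine Int.eq_zero_of_abs_lt_dvd (h _ hk) ?_
  have h1 : (z.natAbs : ℤ) < (N * (z.natAbs + 1) : ℕ) := by
    have : z.natAbs < N * (z.natAbs + 1) := by
      calc z.natAbs < z.natAbs + 1 := Nat.lt_succ_self _
        _ = 1 * (z.natAbs + 1) := (one_mul _).symm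
        _ ≤ N * (z.natAbs + 1) := Nat.mul_le_mul_right _ (Nat.one_le_iff_ne_zero.2 hN)
    exact_mod_cast this
  rwa [Int.abs_eq_natAbs]

/-- `x ⬝ᵥ (G *ᵥ y)` on standard basis vectors is the entry `G i j`. [folklore] -/
private theorem single_dotProduct_map_mulVec_single {n R : Type} [Fintype n] [DecidableEq n] [CommRing R]
    (G : Matrix n n R) (i j : n) :
    (Pi.single i (1 : R) : n → R) ⬝ᵥ G *ᵥ (Pi.single j (1 : R)) = G i j := by
  rw [Matrix.mulVec_single_one, single_dotProduct, one_mul]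
  rfl

end Elementary

/-! ### §1 The Gram matrix of `c₁(Θ^an)` in the frame of a matched marking is `E_δ` -/

section Main

variable {N : ℕ} {S : Scheme} {B : AbelianSchemeOver S} {D : B.DualPair} (pol : B.Polarization D)
  {s : Spec (.of ℂ) ⟶ S} {φL : B.LevelStructure g N}
  {Θ : CartierDivisor (B.fibre s).toAbelianVariety.X.left} {r : gspFinAdelic δ} {Z₀ : Matrix (Fin g) (Fin g) ℂ}

/-- **(G₀) THE FRAME OF A MATCHED ADMISSIBILITY MARKING IS SYMPLECTIC OF TYPE `δ` FOR `c₁(Θ^an)`.**  See the module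
docstring for the statement and the four-step proof.  Hypotheses: `pol` of type `δ` and `λ̄ = Λ(𝒪(Θ))` at `s` (for the
determinant, ★ `HasType.complexTorus_isPolarizationType`), `Θ` ample (positivity, ★ `isRiemannForm_of_isAmple`), `m` a
marking by `[J(Z₀), r]` with `m.γ = 1` matched to the symplectic lift `Λ` through `r ∈ K_δ(1)`.
[cite: Milne2005ShimuraVarieties, §6 Thm. 6.11 pp. 74–75] [cite: Deligne1971TravauxShimura, 4.12 (b) p. 149 and Exemple 4.16 p. 150]
[cite: Lan2013PELCompactifications, §1.3.6 Def. 1.3.6.2 (p. 80) and Lemma 1.3.6.5 (p. 81)] [cite: LangeBirkenhake1992, §8.1 Prop. 8.1.1] -/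
theorem intGram_eq_typeForm_of_symplecticLift (hδ : IsPolarizationType δ) (hg : 0 < g) (hN : N ≠ 0)
    (hT : pol.HasType δ) (hlam : B.IsLambdaOfAt s D pol.lam Θ) (hΘ : Θ.IsAmple)
    (hr : r ∈ principalLevelSubgroup δ 1) (hZ₀ : Z₀ ∈ siegelUpperHalfSpace g)
    (m : SiegelAdelicMarking ⟨jOfSiegel δ Z₀, SiegelComplexRecordSystem.jOfSiegel_mem_C0pm hδ.1 hZ₀⟩ r
      (B.fibre s).toAbelianVariety) (hγ : m.γ = 1)
    (Λ : φL.SymplecticLift s Θ δ)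
    (hΛ : ∀ ⦃M : ℕ⦄, N ∣ M → M ≠ 0 → ∀ (x : Fin g ⊕ Fin g → ZMod M) (v : Fin g ⊕ Fin g → ℚ),
      AdelicCongr ((r⁻¹ : gspFinAdelic δ) : GL (Fin g ⊕ Fin g) finAdeleQ) 1 v (fun i => ((x i).val : ℚ) / M) →
        ((Λ.lift M (Multiplicative.ofAdd x)) : (B.fibre s).toAbelianVariety.Points ℂ) = m.r v)
    (p : AHData m.Ψ) (hp : AHData.toPic p = picClass (cartierDivisorLineBundle m.isAnalytification Θ)) :
    intGram m.Ψ p.form = typeForm δ := by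
  classical
  -- put the marking's chart on D5's model `ℂ^{dim A}` (`g := dim A`)
  obtain rfl : g = (B.fibre s).toAbelianVariety.dim := m.dim_eq.symm
  have hφ := m.isAnalytification
  have hadd := m.toFun_add
  have hr1 : ∀ v : Fin (B.fibre s).toAbelianVariety.dim ⊕ Fin (B.fibre s).toAbelianVariety.dim → ℚ,
      m.r v = m.toFun (proj m.Ψ fun i => ((v i : ℚ) : ℝ)) := m.r_eq_toFun_proj_of_γ_eq_one hγ
  -- the similitude tower of `r⁻¹`
  obtain ⟨Γ, ν, hΓres, -, -, hΓsim⟩ :=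
    exists_similitudeTower δ hδ hg (inv_mem hr : r⁻¹ ∈ principalLevelSubgroup δ 1)
  -- Steps (1)+(2): `G ≡ c • E_δ (mod N·k)` for every `k ≠ 0`
  have hlevel : ∀ k : ℕ, k ≠ 0 → ∃ c : ZMod (N * k),
      ∀ i j, ((intGram m.Ψ p.form i j : ℤ) : ZMod (N * k)) = c * ((typeForm δ i j : ℤ) : ZMod (N * k)) := by
    intro k hk
    have hM0 : N * k ≠ 0 := mul_ne_zero hN hk
    haveI : NeZero (N * k) := ⟨hM0⟩
    have hNM : N ∣ N * k := Dvd.intro k rfl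
    have hMℂ : ((N * k : ℕ) : ℂ) ≠ 0 := by exact_mod_cast hM0
    haveI := AbelianVariety.isDominant_toSchemeHom_zsmul_of_ne_zero (B.fibre s).toAbelianVariety hMℂ
    -- the lift of `Γ_M x` IS the point `m.r (x̃/M) = m.toFun [x̃/M]`
    set ΓM : Matrix (Fin (B.fibre s).toAbelianVariety.dim ⊕ Fin (B.fibre s).toAbelianVariety.dim) (Fin (B.fibre s).toAbelianVariety.dim ⊕ Fin (B.fibre s).toAbelianVariety.dim) (ZMod (N * k)) :=
      ((Γ (N * k) : GL (Fin (B.fibre s).toAbelianVariety.dim ⊕ Fin (B.fibre s).toAbelianVariety.dim) (ZMod (N * k))) : Matrix (Fin (B.fibre s).toAbelianVariety.dim ⊕ Fin (B.fibre s).toAbelianVariety.dim) (Fin (B.fibre s).toAbelianVariety.dim ⊕ Fin (B.fibre s).toAbelianVariety.dim) (ZMod (N * k))) with hΓM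
    have hpt : ∀ x : Fin (B.fibre s).toAbelianVariety.dim ⊕ Fin (B.fibre s).toAbelianVariety.dim → ZMod (N * k),
        ((Λ.lift (N * k) (Multiplicative.ofAdd (ΓM *ᵥ x))) : (B.fibre s).toAbelianVariety.Points ℂ) =
          m.toFun (proj m.Ψ (((N * k : ℕ) : ℝ)⁻¹ • fun i ↦ (((fun j ↦ ((x j).val : ℤ)) i : ℤ) : ℝ))) := by
      intro x
      have hc := adelicCongr_val_div_of_entries_residue (inv_mem hr : r⁻¹ ∈ principalLevelSubgroup δ 1) ΓM
        (hΓres (N * k)) x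
      rw [hΛ hNM hM0 _ _ hc, hr1]
      congr 2
      funext i
      simp only [Pi.smul_apply, smul_eq_mul, Rat.cast_div, Rat.cast_natCast, Int.cast_natCast]
      ring
    -- the two readings of the pairing
    have hζ₀prim : IsPrimitiveRoot (cexp (2 * Real.pi * I / (N * k : ℕ))) (N * k) := Complex.isPrimitiveRoot_exp (N * k) hM0
    obtain ⟨b, -, hbζ⟩ := hζ₀prim.eq_pow_of_pow_eq_one (Λ.ζ_pow_eq_one hNM hM0)
    have hexp : ∀ x y : Fin (B.fibre s).toAbelianVariety.dim ⊕ Fin (B.fibre s).toAbelianVariety.dim → ZMod (N * k),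
        x ⬝ᵥ ((intGram m.Ψ p.form).map (Int.castRingHom (ZMod (N * k)))) *ᵥ y =
          (b : ZMod (N * k)) * ((ν (N * k) : ZMod (N * k)) * AbelianSchemeOver.typeFormMod δ (N * k) x y) := by
      intro x y
      -- D5 reading: `ē = ζ₀ ^ (ᵗx̃ G ỹ mod M)`
      have e1 := AbelianVariety.weilPairingLevel_eq_cexp_intGram hφ hadd hM0 Θ p hp
        (fun j ↦ ((x j).val : ℤ)) (fun j ↦ ((y j).val : ℤ)) _ _ (hpt x) (hpt y)
      rw [cexp_intCast_div_eq_pow' hM0] at e1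
      -- the lift's reading: `ē = ζ ^ E_δ(Γx, Γy) = ζ₀ ^ (b · (ν E_δ(x,y)).val)`
      have e2 := Λ.weilPairingLevel_lift hNM hMℂ (ΓM *ᵥ x) (ΓM *ᵥ y)
      rw [hΓsim hM0, ← hbζ, ← pow_mul] at e2
      rw [e2] at e1
      -- compare exponents modulo `M`
      set n₁ : ℕ := ((ν (N * k) : ZMod (N * k)) * AbelianSchemeOver.typeFormMod δ (N * k) x y).val with hn₁
      have hmod : cexp (2 * Real.pi * I / (N * k : ℕ)) ^ (b * n₁) =
          cexp (2 * Real.pi * I / (N * k : ℕ)) ^ ((b * n₁) % (N * k)) := by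
        conv_lhs => rw [← Nat.mod_add_div (b * n₁) (N * k), pow_add, pow_mul, hζ₀prim.pow_eq_one, one_pow, mul_one]
      rw [hmod] at e1
      have hval := hζ₀prim.pow_inj (Nat.mod_lt _ (Nat.pos_of_ne_zero hM0)) (ZMod.val_lt _) e1
      have hz : (((b * n₁ : ℕ)) : ZMod (N * k)) =
          ((((fun i ↦ ((x i).val : ℤ)) ⬝ᵥ (intGram m.Ψ p.form) *ᵥ (fun i ↦ ((y i).val : ℤ)) : ℤ)) : ZMod (N * k)) := by
        have := congrArg (fun t : ℕ => (t : ZMod (N * k))) hval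
        simpa only [ZMod.natCast_mod, ZMod.natCast_zmod_val] using this
      rw [Nat.cast_mul, hn₁, ZMod.natCast_zmod_val, intCast_dotProduct_mulVec_val] at hz
      exact hz.symm
    refine ⟨(b : ZMod (N * k)) * (ν (N * k) : ZMod (N * k)), fun i j => ?_⟩
    have hij := hexp (Pi.single i 1) (Pi.single j 1)
    rw [single_dotProduct_map_mulVec_single, typeFormMod_eq_dotProduct, single_dotProduct_map_mulVec_single,
      typeFormOver_apply, Matrix.map_apply, eq_intCast] at hij
    rw [mul_assoc, hij]
  -- Step (2'): over `ℤ`, `d • G = t • E_δ` with `d = δ₀`, `t = G_{λ₀ μ₀}`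
  have hdG : (typeForm δ (Sum.inl ⟨0, hg⟩) (Sum.inr ⟨0, hg⟩)) • intGram m.Ψ p.form =
      (intGram m.Ψ p.form (Sum.inl ⟨0, hg⟩) (Sum.inr ⟨0, hg⟩)) • typeForm δ := by
    ext i j
    rw [Matrix.smul_apply, Matrix.smul_apply, smul_eq_mul, smul_eq_mul]
    have hz : typeForm δ (Sum.inl ⟨0, hg⟩) (Sum.inr ⟨0, hg⟩) * intGram m.Ψ p.form i j -
        intGram m.Ψ p.form (Sum.inl ⟨0, hg⟩) (Sum.inr ⟨0, hg⟩) * typeForm δ i j = 0 := by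
      refine int_eq_zero_of_forall_dvd' hN fun k hk => ?_
      obtain ⟨c, hc⟩ := hlevel k hk
      rw [← ZMod.intCast_zmod_eq_zero_iff_dvd]
      push_cast
      rw [hc i j, hc (Sum.inl ⟨0, hg⟩) (Sum.inr ⟨0, hg⟩)]
      ring
    linarith
  -- Step (3): determinants — both `G` and `E_δ` have determinant `(∏ δᵢ)²`
  have hd : typeForm δ (Sum.inl ⟨0, hg⟩) (Sum.inr ⟨0, hg⟩) = (δ ⟨0, hg⟩ : ℤ) := by
    rw [typeForm, Matrix.fromBlocks_apply₁₂, Matrix.diagonal_apply_eq]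
  have hdpos : (0 : ℤ) < typeForm δ (Sum.inl ⟨0, hg⟩) (Sum.inr ⟨0, hg⟩) := by
    rw [hd]; exact_mod_cast hδ.1 ⟨0, hg⟩
  have hR : IsRiemannForm m.Ψ p.form := (B.fibre s).toAbelianVariety.isRiemannForm_of_isAmple hφ hadd hΘ p hp
  have htype : ComplexTorus.IsPolarizationType m.Ψ p.form δ :=
    AbelianSchemes.AbelianSchemeOver.Polarization.HasType.complexTorus_isPolarizationType pol hT s hlam hφ hadd rfl p
      hp hR
  have hdetG : (intGram m.Ψ p.form).det = ((∏ i, δ i) ^ 2 : ℕ) :=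
    htype.det_intGram_eq_sq m.Ψ (map_intGram m.Ψ p.isNSForm_form)
  have hdetE : (typeForm δ).det = ((∏ i, δ i) ^ 2 : ℕ) := by
    have hI := I_smul_one_mem_siegelUpperHalfSpace (B.fibre s).toAbelianVariety.dim
    exact (isPolarizationType_siegelForm hδ.1 hI hδ.2).det_intGram_eq_sq (siegelPeriodEquiv hδ.1 hI)
      (latticeGram_siegelForm hδ.1 hI).symm
  have hprod : (((∏ i, δ i) ^ 2 : ℕ) : ℤ) ≠ 0 := by
    exact_mod_cast pow_ne_zero _ (Finset.prod_ne_zero_iff.2 fun i _ => (hδ.1 i).ne')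
  have htd : intGram m.Ψ p.form (Sum.inl ⟨0, hg⟩) (Sum.inr ⟨0, hg⟩) = typeForm δ (Sum.inl ⟨0, hg⟩) (Sum.inr ⟨0, hg⟩) ∨
      intGram m.Ψ p.form (Sum.inl ⟨0, hg⟩) (Sum.inr ⟨0, hg⟩) = -typeForm δ (Sum.inl ⟨0, hg⟩) (Sum.inr ⟨0, hg⟩) := by
    have h1 := congrArg Matrix.det hdG
    rw [Matrix.det_smul, Matrix.det_smul, hdetG, hdetE, Fintype.card_sum, Fintype.card_fin] at h1
    have h2 := mul_right_cancel₀ hprod h1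
    have h5 : (typeForm δ (Sum.inl ⟨0, hg⟩) (Sum.inr ⟨0, hg⟩)).natAbs ^
          ((B.fibre s).toAbelianVariety.dim + (B.fibre s).toAbelianVariety.dim) =
        (intGram m.Ψ p.form (Sum.inl ⟨0, hg⟩) (Sum.inr ⟨0, hg⟩)).natAbs ^
          ((B.fibre s).toAbelianVariety.dim + (B.fibre s).toAbelianVariety.dim) := by
      have h4 : ((typeForm δ (Sum.inl ⟨0, hg⟩) (Sum.inr ⟨0, hg⟩)).natAbs : ℤ) ^
            ((B.fibre s).toAbelianVariety.dim + (B.fibre s).toAbelianVariety.dim) =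
          ((intGram m.Ψ p.form (Sum.inl ⟨0, hg⟩) (Sum.inr ⟨0, hg⟩)).natAbs : ℤ) ^
            ((B.fibre s).toAbelianVariety.dim + (B.fibre s).toAbelianVariety.dim) := by
        rw [Int.natCast_natAbs, Int.natCast_natAbs, ← abs_pow, ← abs_pow, h2]
      exact_mod_cast h4
    have h3 := Nat.pow_left_injective (by omega : (B.fibre s).toAbelianVariety.dim + (B.fibre s).toAbelianVariety.dim ≠ 0) h5
    rcases Int.natAbs_eq_natAbs_iff.1 h3.symm with h | h
    · exact Or.inl h
    · exact Or.inr h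
  -- Step (4): the sign — `G = -E_δ` contradicts positivity against the Siegel model at `Z₀`
  rcases htd with htd | htd
  · rw [htd] at hdG
    exact smul_right_injective _ hdpos.ne' hdG
  · exfalso
    have hGneg : intGram m.Ψ p.form = -typeForm δ := by
      have h1 : (typeForm δ (Sum.inl ⟨0, hg⟩) (Sum.inr ⟨0, hg⟩)) • intGram m.Ψ p.form =
          (typeForm δ (Sum.inl ⟨0, hg⟩) (Sum.inr ⟨0, hg⟩)) • (-typeForm δ) := by
        rw [hdG, htd, neg_smul, smul_neg]
      exact smul_right_injective _ hdpos.ne' h1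
    -- the test vector `x₀ = e_{λ₀}` and the quantity `q = ᵗ(J x₀) E_δ x₀`
    have hx₀ne : (Pi.single (Sum.inl ⟨0, hg⟩) (1 : ℝ) : Fin (B.fibre s).toAbelianVariety.dim ⊕ Fin (B.fibre s).toAbelianVariety.dim → ℝ) ≠ 0 := by
      intro h
      have := congrFun h (Sum.inl ⟨0, hg⟩)
      simp at this
    -- model positivity: `0 < E_{Z₀}(i Φ_{Z₀} x₀, Φ_{Z₀} x₀) = ᵗ(J x₀) E_δ x₀`
    have hmodel : 0 < (jOfSiegel δ Z₀ *ᵥ (Pi.single (Sum.inl ⟨0, hg⟩) (1 : ℝ))) ⬝ᵥ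
        ((typeForm δ).map (Int.cast : ℤ → ℝ)) *ᵥ (Pi.single (Sum.inl ⟨0, hg⟩) (1 : ℝ)) := by
      have hpos := (isRiemannForm_siegelForm hδ.1 hZ₀).2.2 (siegelPeriodEquiv hδ.1 hZ₀ (Pi.single (Sum.inl ⟨0, hg⟩) 1))
        (fun h => hx₀ne ((siegelPeriodEquiv hδ.1 hZ₀).injective (by rw [h, map_zero])))
      rwa [siegelPeriodEquiv_apply, ← siegelPeriodMap_jOfSiegel_mulVec hδ.1 hZ₀, ← siegelPeriodEquiv_apply hδ.1 hZ₀,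
        ← siegelPeriodEquiv_apply hδ.1 hZ₀, ← dotProduct_latticeGram_mulVec, latticeGram_siegelForm] at hpos
    -- our positivity: `0 < p.form(i Ψ x₀, Ψ x₀) = ᵗ(J x₀) G_ℝ x₀ = -ᵗ(J x₀) E_δ x₀`
    have hours : 0 < -((jOfSiegel δ Z₀ *ᵥ (Pi.single (Sum.inl ⟨0, hg⟩) (1 : ℝ))) ⬝ᵥ
        ((typeForm δ).map (Int.cast : ℤ → ℝ)) *ᵥ (Pi.single (Sum.inl ⟨0, hg⟩) (1 : ℝ))) := by
      have hpos := hR.2.2 (m.Ψ (Pi.single (Sum.inl ⟨0, hg⟩) 1))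
        (fun h => hx₀ne (m.Ψ.injective (by rw [h, map_zero])))
      have hJ : Complex.I • m.Ψ (Pi.single (Sum.inl ⟨0, hg⟩) 1) =
          m.Ψ (jOfSiegel δ Z₀ *ᵥ (Pi.single (Sum.inl ⟨0, hg⟩) (1 : ℝ))) := by
        have h := m.Ψ_J (Pi.single (Sum.inl ⟨0, hg⟩) 1)
        rw [hγ, inv_one, Units.val_one, Matrix.map_one _ (map_zero _) (map_one _), Matrix.one_mulVec,
          Matrix.one_mulVec] at h
        exact h.symm
      rw [hJ, ← dotProduct_latticeGram_mulVec, ← map_intGram m.Ψ p.isNSForm_form, hGneg,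
        Matrix.map_neg _ (fun a => (Int.cast_neg a)), Matrix.neg_mulVec, dotProduct_neg] at hpos
      exact hpos
    linarith

/-- **(G₀) in the `IsFlatGram` currency**: under the hypotheses of `intGram_eq_typeForm_of_symplecticLift` there IS an
Appell–Humbert datum of `[𝒪(Θ)^an]` on the marking's uniformisation with integer Gram matrix `E_δ` (★ `AHData.toPic_surjective`)
— the clause of B-typ02 (g11)'s `SiegelMarkingFamily.IsFlatGram` at the base point, and the `hgram` input of ★ (B4)
`exists_pairingRead_forall_of_intGram_eq_typeForm`. [cite: Milne2005ShimuraVarieties, §6 Thm. 6.11 pp. 74–75]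
[cite: Deligne1971TravauxShimura, 4.12 (b) p. 149] -/
theorem exists_ahData_intGram_eq_typeForm_of_symplecticLift (hδ : IsPolarizationType δ) (hg : 0 < g) (hN : N ≠ 0)
    (hT : pol.HasType δ) (hlam : B.IsLambdaOfAt s D pol.lam Θ) (hΘ : Θ.IsAmple)
    (hr : r ∈ principalLevelSubgroup δ 1) (hZ₀ : Z₀ ∈ siegelUpperHalfSpace g)
    (m : SiegelAdelicMarking ⟨jOfSiegel δ Z₀, SiegelComplexRecordSystem.jOfSiegel_mem_C0pm hδ.1 hZ₀⟩ r
      (B.fibre s).toAbelianVariety) (hγ : m.γ = 1)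
    (Λ : φL.SymplecticLift s Θ δ)
    (hΛ : ∀ ⦃M : ℕ⦄, N ∣ M → M ≠ 0 → ∀ (x : Fin g ⊕ Fin g → ZMod M) (v : Fin g ⊕ Fin g → ℚ),
      AdelicCongr ((r⁻¹ : gspFinAdelic δ) : GL (Fin g ⊕ Fin g) finAdeleQ) 1 v (fun i => ((x i).val : ℚ) / M) →
        ((Λ.lift M (Multiplicative.ofAdd x)) : (B.fibre s).toAbelianVariety.Points ℂ) = m.r v) :
    ∃ p : AHData m.Ψ, AHData.toPic p = picClass (cartierDivisorLineBundle m.isAnalytification Θ) ∧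
      intGram m.Ψ p.form = typeForm δ := by
  obtain ⟨p, hp⟩ := AHData.toPic_surjective (picClass (cartierDivisorLineBundle m.isAnalytification Θ))
  exact ⟨p, hp, intGram_eq_typeForm_of_symplecticLift pol hδ hg hN hT hlam hΘ hr hZ₀ m hγ Λ hΛ p hp⟩

end Main

end Literature.AlgebraicGeometry.ModuliOfAbelianVarieties

end
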